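import Mathlib.Analysis.SpecialFunctions.Exp
import Mathlib.Analysis.SpecialFunctions.Log.Basic
import Mathlib.Order.ConditionallyCompleteLattice.Basic
import Mathlib.Topology.Order.Basic
import HarnessLib

/-!
# A Gronwall lemma for the two-point inequality with a supremum

Analysis/FluidPDE support file (serves the discharge of
`Literature.Analysis.FluidPDE.cheskidov_shvydkoy`, ns.S31). The `H¹` a-priori estimate behind
Cheskidov–Shvydkoy's Lemma 3.2 (arXiv:0708.3067, p. 6: "Gronwall's Lemma implies that `u(t)` is
bounded in `H^{(1+ε)/2}` up to `t = β`") is obtained in the tree from the integrated block energy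
balance, which yields — without any differentiability or measurability in time — the two-point
inequality `f(t) ≤ f(s) + (t - s)(G + K sup_{[s,t]} f)` for the dyadic energy `f`. This file proves
the elementary Gronwall conclusion for such inequalities (partition `[a, b]` into `n` steps with
`K (b-a)/n ≤ 1/2` and iterate):

* `le_mul_exp_of_two_point_sup` : `f(b) ≤ (f(a) + G (b - a)) · exp (2 K (b - a))`.

## References

* A. Cheskidov, R. Shvydkoy, Arch. Ration. Mech. Anal. 195 (2010), proof of Lemma 3.2, p. 6.
  [CheskidovShvydkoy2010]
-/

noncomputable section

open Set Real

namespace Literature.Analysis.FluidPDE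

/-- One step of the iteration: on `[s, t]` with `K (t - s) ≤ 1/2`, the two-point inequality gives
`sup_{[s,t]} f ≤ (1 + 2K(t-s)) (f(s) + G (t-s))`. [folklore] -/
theorem sSup_image_Icc_le_of_two_point {f : ℝ → ℝ} {s t G K B : ℝ} (hst : s ≤ t) (hG : 0 ≤ G) (hK : 0 ≤ K)
    (hB : ∀ τ ∈ Icc s t, f τ ≤ B) (hf0 : ∀ τ ∈ Icc s t, 0 ≤ f τ)
    (h2 : ∀ τ ∈ Icc s t, f τ ≤ f s + (τ - s) * (G + K * sSup (f '' Icc s τ)))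
    (hsmall : K * (t - s) ≤ 1 / 2) :
    sSup (f '' Icc s t) ≤ (1 + 2 * (K * (t - s))) * (f s + G * (t - s)) := by
  set M := sSup (f '' Icc s t) with hM
  have hne : (f '' Icc s t).Nonempty := ⟨f s, s, ⟨le_rfl, hst⟩, rfl⟩
  have hbdd : BddAbove (f '' Icc s t) := ⟨B, by rintro _ ⟨τ, hτ, rfl⟩; exact hB τ hτ⟩
  -- `M ≤ f s + (t - s) (G + K M)`
  have hMle : M ≤ f s + (t - s) * (G + K * M) := by
    refine csSup_le hne ?_
    rintro _ ⟨τ, hτ, rfl⟩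
    refine (h2 τ hτ).trans ?_
    have hsub : sSup (f '' Icc s τ) ≤ M :=
      csSup_le_csSup hbdd ⟨f s, s, ⟨le_rfl, hτ.1⟩, rfl⟩ (image_mono (Icc_subset_Icc le_rfl hτ.2))
    have hMnn : 0 ≤ G + K * sSup (f '' Icc s τ) := by
      have : 0 ≤ sSup (f '' Icc s τ) :=
        le_csSup_of_le (hbdd.mono (image_mono (Icc_subset_Icc le_rfl hτ.2))) ⟨s, ⟨le_rfl, hτ.1⟩, rfl⟩ (hf0 s ⟨le_rfl, hst⟩)
      positivity
    calc f s + (τ - s) * (G + K * sSup (f '' Icc s τ)) ≤ f s + (t - s) * (G + K * sSup (f '' Icc s τ)) := by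
          gcongr; exact hτ.2
      _ ≤ f s + (t - s) * (G + K * M) := by gcongr
  -- solve for `M`
  have hx : K * (t - s) ≤ 1 / 2 := hsmall
  have hx0 : 0 ≤ K * (t - s) := mul_nonneg hK (sub_nonneg.2 hst)
  have hfs : 0 ≤ f s := hf0 s ⟨le_rfl, hst⟩
  have h1 : M * (1 - K * (t - s)) ≤ f s + G * (t - s) := by nlinarith
  have h1' : M ≤ (f s + G * (t - s)) / (1 - K * (t - s)) := by
    rw [le_div_iff₀ (by linarith)]; exact h1
  refine h1'.trans ?_
  rw [div_le_iff₀ (by linarith)]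
  have hP : 0 ≤ f s + G * (t - s) := by positivity
  -- `1 ≤ (1 + 2x)(1 - x)` for `0 ≤ x ≤ 1/2`
  nlinarith [mul_nonneg hP hx0, mul_nonneg (mul_nonneg hP hx0) (by linarith : 0 ≤ 1 / 2 - K * (t - s))]

/-- **Gronwall for the two-point inequality with a supremum.** Let `f ≥ 0` be bounded on `[a, b]` and
satisfy `f(τ) ≤ f(s) + (τ - s)(G + K sup_{[s,τ]} f)` for `a ≤ s ≤ τ ≤ b` (`G, K ≥ 0`). Then
`f(b) ≤ (f(a) + G (b - a)) exp (2K(b - a))`. [folklore] -/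
theorem le_mul_exp_of_two_point_sup {f : ℝ → ℝ} {a b G K B : ℝ} (hab : a ≤ b) (hG : 0 ≤ G) (hK : 0 ≤ K)
    (hB : ∀ τ ∈ Icc a b, f τ ≤ B) (hf0 : ∀ τ ∈ Icc a b, 0 ≤ f τ)
    (h2 : ∀ s ∈ Icc a b, ∀ τ ∈ Icc s b, f τ ≤ f s + (τ - s) * (G + K * sSup (f '' Icc s τ))) :
    f b ≤ (f a + G * (b - a)) * Real.exp (2 * K * (b - a)) := by
  -- number of steps
  obtain ⟨n, hn⟩ : ∃ n : ℕ, 2 * K * (b - a) ≤ n := exists_nat_ge _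
  set N := n + 1 with hN
  have hNpos : (0 : ℝ) < N := by positivity
  set h := (b - a) / N with hh
  have hh0 : 0 ≤ h := div_nonneg (sub_nonneg.2 hab) hNpos.le
  have hsmall : K * h ≤ 1 / 2 := by
    rw [hh, mul_div_assoc']
    rw [div_le_iff₀ hNpos]
    have : (n : ℝ) ≤ N := by simp [hN]
    nlinarith
  set τ : ℕ → ℝ := fun k => a + k * h with hτ
  have hτ_mem : ∀ k, k ≤ N → τ k ∈ Icc a b := by
    intro k hk
    refine ⟨by simp [hτ]; positivity, ?_⟩
    simp only [hτ]
    have hk' : (k : ℝ) ≤ N := by exact_mod_cast hk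
    calc a + k * h ≤ a + N * h := by gcongr
      _ = b := by rw [hh]; field_simp; ring
  have hτ_succ : ∀ k, τ (k + 1) = τ k + h := fun k => by simp [hτ]; ring
  -- the iteration
  have hiter : ∀ k, k ≤ N → f (τ k) ≤ (1 + 2 * (K * h)) ^ k * (f a + k * (G * h)) := by
    intro k
    induction k with
    | zero => intro _; simp [hτ]
    | succ k ih =>
      intro hk
      have hk' : k ≤ N := Nat.le_of_succ_le hk
      have hmem := hτ_mem k hk'
      have hmem1 := hτ_mem (k + 1) hk
      have hstep : f (τ (k + 1)) ≤ (1 + 2 * (K * h)) * (f (τ k) + G * h) := by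
        have hsup := sSup_image_Icc_le_of_two_point (f := f) (s := τ k) (t := τ (k + 1)) (G := G) (K := K) (B := B)
          (by rw [hτ_succ]; linarith) hG hK (fun σ hσ => hB σ ⟨hmem.1.trans hσ.1, hσ.2.trans hmem1.2⟩)
          (fun σ hσ => hf0 σ ⟨hmem.1.trans hσ.1, hσ.2.trans hmem1.2⟩)
          (fun σ hσ => h2 (τ k) hmem σ ⟨hσ.1, hσ.2.trans hmem1.2⟩) (by rw [hτ_succ]; simpa using hsmall)
        rw [hτ_succ, add_sub_cancel_left] at hsup
        refine le_trans ?_ hsup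
        rw [← hτ_succ]
        exact le_csSup ⟨B, by rintro _ ⟨σ, hσ, rfl⟩; exact hB σ ⟨hmem.1.trans hσ.1, hσ.2.trans hmem1.2⟩⟩
          ⟨τ (k + 1), ⟨by rw [hτ_succ]; linarith, le_rfl⟩, rfl⟩
      refine hstep.trans ?_
      have hKh : 0 ≤ K * h := mul_nonneg hK hh0
      have hq : 0 ≤ 1 + 2 * (K * h) := by positivity
      have hGh : 0 ≤ G * h := mul_nonneg hG hh0
      have hpow : G * h ≤ (1 + 2 * (K * h)) ^ k * (G * h) :=
        le_mul_of_one_le_left hGh (one_le_pow₀ (by linarith))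
      calc (1 + 2 * (K * h)) * (f (τ k) + G * h) ≤ (1 + 2 * (K * h)) * ((1 + 2 * (K * h)) ^ k * (f a + k * (G * h)) + G * h) :=
            mul_le_mul_of_nonneg_left (add_le_add_left (ih hk') _) hq
        _ ≤ (1 + 2 * (K * h)) * ((1 + 2 * (K * h)) ^ k * (f a + k * (G * h)) + (1 + 2 * (K * h)) ^ k * (G * h)) :=
            mul_le_mul_of_nonneg_left (add_le_add_right hpow _) hq
        _ = (1 + 2 * (K * h)) ^ (k + 1) * (f a + (k + 1 : ℕ) * (G * h)) := by push_cast; ring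
  have hfin := hiter N le_rfl
  have hτN : τ N = b := by simp only [hτ]; rw [hh]; field_simp; ring
  rw [hτN] at hfin
  refine hfin.trans ?_
  have hNh : (N : ℝ) * (G * h) = G * (b - a) := by rw [hh]; field_simp
  rw [hNh]
  have hfa : 0 ≤ f a + G * (b - a) := by
    have := hf0 a ⟨le_rfl, hab⟩; positivity
  rw [mul_comm (f a + G * (b - a))]
  refine mul_le_mul_of_nonneg_right ?_ hfa
  -- `(1 + 2Kh)^N ≤ exp(2KhN) = exp(2K(b-a))`
  calc (1 + 2 * (K * h)) ^ N ≤ (Real.exp (2 * (K * h))) ^ N := by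
        gcongr
        linarith [Real.add_one_le_exp (2 * (K * h))]
    _ = Real.exp (2 * K * (b - a)) := by
        rw [← Real.exp_nat_mul, hh]; congr 1; field_simp

end Literature.Analysis.FluidPDE

end
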